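import Mathlib.Analysis.SpecialFunctions.Pow.Real

/-!
# drefute sharpening S5.1 for line `kinetic-entropy-collision-budget` (crux stmt-AtomisticToContinuum-14135)

Pure real arithmetic, kernel-checked: given the TRUE stubs 1–3 of the line (Gibbs duality `K = E_Q[2A] − log Z` with
`log Z ≥ 0`, i.e. `K ≤ E`; the Hellinger bias split `E ≤ 2M(2κ√f + κc)`; the one-body entropy budget `Mc ≤ K`), the two
allowances `C·K/H` and `A·K²/M` of `stub_fastSectorDominance` are absorbable, so the stub is equivalent (up to shrinking the
amplitude `κ₁`) to its allowance-free form `FSD₀ : … fd(Π̄(Q)) ≤ η`, and the composition arithmetic collapses to `pressure_arith₀`.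
Notation as in the skeleton's `pressure_arith`: `M = N+1`, `K = KL(Q‖G_N)`, `f = fd(Π̄(Q))`, `c = condKL(Π̄(Q))`,
`E = E_Q[2A] = 2M∫φ⊗g dΠ̄(Q)`.
-/

namespace Summit.AtomisticToContinuum.HydrodynamicLimit.Cruxes.CorrectorPressureDecay.KineticEntropyCollisionBudget.Drefute

/-- S5.1(a): `log Z ≥ 0` (`K ≤ E`), the bias split and the budget squeeze the optimiser's entropy by its fast deviation:
`K ≤ 8κM√f` for `κ ≤ 1/4`. -/
theorem entropy_le_of_bias {M K f c κ E : ℝ} (hK : 0 ≤ K) (hκ : 0 ≤ κ)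
    (hκ4 : κ ≤ 1 / 4) (hbudget : M * c ≤ K) (hKE : K ≤ E)
    (hE : E ≤ 2 * M * (2 * κ * Real.sqrt f + κ * c)) :
    K ≤ 8 * κ * M * Real.sqrt f := by
  have h1 : K ≤ 4 * κ * M * Real.sqrt f + 2 * κ * (M * c) := by nlinarith
  have h2 : 2 * κ * (M * c) ≤ 2 * κ * K := by nlinarith
  have h3 : K * (1 - 2 * κ) ≤ 4 * κ * M * Real.sqrt f := by nlinarith
  have h4 : K / 2 ≤ K * (1 - 2 * κ) := by nlinarith
  linarith

/-- S5.1(b): hence the `A·K²/M` allowance is at most half of the left side `M·f` once `128·A·κ² ≤ 1`. -/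
theorem allowance_le_half {M K f κ A : ℝ} (hM : 0 < M) (hf : 0 ≤ f) (hA : 0 ≤ A)
    (hAκ : 128 * A * κ ^ 2 ≤ 1) (hK : 0 ≤ K) (hKf : K ≤ 8 * κ * M * Real.sqrt f) :
    A * K ^ 2 / M ≤ M * f / 2 := by
  rw [div_le_iff₀ hM]
  have hsq : K ^ 2 ≤ 64 * κ ^ 2 * M ^ 2 * f := by
    have h := mul_self_le_mul_self hK hKf
    have h' : (8 * κ * M * Real.sqrt f) * (8 * κ * M * Real.sqrt f) = 64 * κ ^ 2 * M ^ 2 * f := by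
      have hss := Real.mul_self_sqrt hf
      linear_combination (64 * κ ^ 2 * M ^ 2) * hss
    nlinarith [h, h']
  have hMf : 0 ≤ M ^ 2 * f := by positivity
  nlinarith [mul_le_mul_of_nonneg_left hsq hA, mul_le_mul_of_nonneg_right hAκ hMf]

/-- S5.1(c): `FastSectorDominance` with constants `(A, C)` implies its allowance-free form: if
`M f ≤ C K/H + A K²/M + η M`, `K ≤ 8κM√f` (S5.1(a)), `128Aκ² ≤ 1`, `K ≤ 2κM` (`log Z ≥ 0`, `|A| ≤ κM`) and the window is
long, `8Cκ ≤ ηH`, then `f ≤ 3η`. -/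
theorem fsd₀_of_fsd {M K f κ A C H η : ℝ} (hM : 0 < M) (hf : 0 ≤ f) (hA : 0 ≤ A)
    (hAκ : 128 * A * κ ^ 2 ≤ 1) (hK : 0 ≤ K) (hKf : K ≤ 8 * κ * M * Real.sqrt f) (hC : 0 ≤ C)
    (hH : 0 < H) (hK2 : K ≤ 2 * κ * M) (hHC : 8 * C * κ ≤ η * H)
    (hdom : M * f ≤ C * K / H + A * K ^ 2 / M + η * M) : f ≤ 3 * η := by
  have h1 : A * K ^ 2 / M ≤ M * f / 2 := allowance_le_half hM hf hA hAκ hK hKf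
  have h2 : C * K / H ≤ η * M / 4 := by
    rw [div_le_iff₀ hH]
    have h3 : C * K ≤ C * (2 * κ * M) := mul_le_mul_of_nonneg_left hK2 hC
    have h4 : (8 * C * κ) * M ≤ (η * H) * M := mul_le_mul_of_nonneg_right hHC hM.le
    nlinarith
  have h5 : M * f ≤ η * M / 4 + M * f / 2 + η * M := by linarith
  have h6 : M * f ≤ M * (3 * η) := by nlinarith
  exact le_of_mul_le_mul_left h6 hM

/-- S5.1(d): the collapsed composition arithmetic replacing `pressure_arith` once stub 5 is the allowance-free `FSD₀`:
from the split `E ≤ 2M(2κ√f + κc)`, the budget `Mc ≤ K`, `κ ≤ 1/2` and `16κ²f ≤ δ²` (i.e. `f ≤ (δ/4κ)²`, the `η` to feed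
into `FSD₀`) conclude `E − K ≤ δM`. No `A`, `C`, `H`, AM–GM. -/
theorem pressure_arith₀ {M K f c κ δ E : ℝ} (hM : 0 < M) (hK : 0 ≤ K) (hκ : 0 ≤ κ)
    (hκ2 : κ ≤ 1 / 2) (hδ : 0 ≤ δ) (hbudget : M * c ≤ K) (hfd : 16 * κ ^ 2 * f ≤ δ ^ 2)
    (hE : E ≤ 2 * M * (2 * κ * Real.sqrt f + κ * c)) : E - K ≤ δ * M := by
  have h16 : Real.sqrt (16 * κ ^ 2 * f) ≤ Real.sqrt (δ ^ 2) := Real.sqrt_le_sqrt hfd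
  rw [Real.sqrt_sq hδ, show (16 : ℝ) * κ ^ 2 * f = (4 * κ) ^ 2 * f by ring,
    Real.sqrt_mul (by positivity) f, Real.sqrt_sq (by positivity)] at h16
  -- h16 : 4 * κ * √f ≤ δ
  have h1 : E ≤ 4 * κ * M * Real.sqrt f + 2 * κ * (M * c) := by nlinarith
  have h2 : 2 * κ * (M * c) ≤ 2 * κ * K := by nlinarith
  have h3 : 2 * κ * K ≤ K := by nlinarith
  have h4 : 4 * κ * M * Real.sqrt f ≤ δ * M := by nlinarith [mul_le_mul_of_nonneg_right h16 hM.le]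
  linarith

end Summit.AtomisticToContinuum.HydrodynamicLimit.Cruxes.CorrectorPressureDecay.KineticEntropyCollisionBudget.Drefute
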